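import Summits.ResolutionOfSingularities.ResolutionOfSingularities.Theorems.SharpStrataDefs
import Summits.ResolutionOfSingularities.ResolutionOfSingularities.Theorems.SharpStrataResSepExcIsolatedCore
import HarnessLib

/-!
# Crux `SharpStrata.ResSepExc` (stmt-16829): the registered cut is EXACT, and each named stub
# statement is closed by the corresponding crux of route `IsolatedCore`

The line `Cruxes/ResSepExc/Lines/birth.lean` cuts the crux `ResSepExc` (separably exceptional
integral varieties over perfect fields of characteristic `p` are resolvable) into the two named
stub statements of `Theorems/SharpStrataDefs.lean`:
`IsolatedModelsInChar p` (stub `stub_isolateSingularities`: a proper birational integral model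
with isolated singularities) and `ResolutionOfIsolatedInChar p` (stub `stub_isolatedResolution`:
varieties with isolated singularities over perfect fields are resolvable).
`SharpStrataDefs` proves `resSepExc_of` (the two stubs give the crux) and
`resolutionOfIsolatedInChar_of_resSepExc` (the crux gives the second stub). This file closes the
square — every theorem PROVED, no definition:

* `isolatedModelsInChar_of_resSepExc` — the crux gives the FIRST stub as well: a resolution
  `π : X' → X` handed out by the crux is an isolated-singularity model (`X'` regular ⇒ reduced ⇒
  integral, being birational over the integral `X`; regular ⇒ isolated singularities).
* `resSepExc_iff_stubs` — hence **`ResSepExc ↔ (∀ p, IsolatedModelsInChar p) ∧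
  (∀ p, ResolutionOfIsolatedInChar p)`**: the cut is exact, each stub is a NECESSARY condition
  for the crux, and no reshaping inside the line can make a stub easier than the corresponding
  special case of the crux.
* `isolatedModelsInChar_of_finiteSingularModels` — crux `W` of route `IsolatedCore`
  (`IsolatedCore.FiniteSingularModels`, stmt-18020) implies the first stub statement at every
  prime, with the hypothesis `SepExc X` idle (named-statement form of
  `exists_model_regular_or_isClosed_of_finiteSingularModels`).
* `resolutionOfIsolatedInChar_of_isolatedResolution` — crux `K` of route `IsolatedCore`
  (`IsolatedCore.IsolatedResolution`, stmt-18021) implies the second stub statement at every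
  prime (named-statement form of `hasResolution_of_isolatedResolution_of_regular_or_isClosed`).

Net (with `hasResolution_of_resSepExc_of_finite_nonRegular` of the imported file): on integral
varieties over perfect fields the second stub IS the corresponding case of `K`, it is necessary
for the crux, and `W ∧ K → ResSepExc`; the crux is parked on stmt-18021 (and stmt-18020).

Added by lead c2 (same topic, appended):
* `exists_model_isolatedSing_of_sepExcModels_of_isolatedModelsInChar`,
  `finite_nonRegular_model_of_sepExcModels_of_isolatedModelsInChar` — modulo the route's OTHER
  crux `SepExcModels` (stmt-16828), the first stub gives isolated-singularity models of ALL
  integral varieties over perfect fields, i.e. the integral perfect-field case of `W` (compose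
  the separably exceptional model with the isolated-singularity model of it); so on this route
  stub 1 sits between `W` and `W|(integral, perfect)`.
* `isolatedCore_integral_perfect_of_sepExcModels_of_resSepExc` — hence `SepExcModels ∧
  ResSepExc` gives both `IsolatedCore` cruxes on integral varieties over perfect fields: beyond
  Benito–Piltant–Reguera's Question 6.6 (`SepExcModels`) the route's resolution content is
  exactly route `IsolatedCore`'s, restricted to integral varieties over perfect fields.
-/

noncomputable section

-- single-problem summit: the doubled namespace component `ResolutionOfSingularities` is forced
set_option linter.dupNamespace false

open CategoryTheory AlgebraicGeometry Literature.AlgebraicGeometry.Resolution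
open Summit.ResolutionOfSingularities.ResolutionOfSingularities.Theses

namespace Summit.ResolutionOfSingularities.ResolutionOfSingularities.Theorems.SharpStrata

/-! ## The crux implies its first stub; the cut is exact -/

/-- **The crux dominates the stratum-generic stub too**: `ResSepExc` implies the existence of
isolated-singularity models of separably exceptional varieties in every prime characteristic —
a resolution `π : X' → X` given by the crux is such a model (`X'` is reduced, being regular,
hence integral, being birational over the integral `X`; a regular scheme has isolated
singularities). [folklore] -/
theorem isolatedModelsInChar_of_resSepExc (h : SharpStrata.ResSepExc) {p : ℕ} (hp : p.Prime) :
    IsolatedModelsInChar p := by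
  intro k _ _ _ X _ f hs hl hq hX
  obtain ⟨X', π, hπ⟩ := h p hp k X f hs hl hq hX
  haveI : IsReduced X' := hπ.isRegular.isReduced
  exact ⟨X', hπ.isBirational.isIntegral, π, hπ.isProper, hπ.isBirational,
    isolatedSing_of_isRegular hπ.isRegular⟩

/-- **Exact calibration of the registered cut.** The crux `ResSepExc` (stmt-16829) is
EQUIVALENT to the conjunction, over all primes `p`, of its two registered stub statements
`IsolatedModelsInChar p` (stub `stub_isolateSingularities`) and `ResolutionOfIsolatedInChar p`
(stub `stub_isolatedResolution`): `resSepExc_of` is one direction, and the crux implies each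
stub (`isolatedModelsInChar_of_resSepExc`, `resolutionOfIsolatedInChar_of_resSepExc`). So the
line `Cruxes/ResSepExc/Lines/birth.lean` loses nothing relative to the crux itself (not merely
relative to the summit, `stubs_of_resolutionOfSingularities`). [folklore] -/
theorem resSepExc_iff_stubs :
    SharpStrata.ResSepExc ↔
      (∀ p : ℕ, p.Prime → IsolatedModelsInChar p) ∧
        (∀ p : ℕ, p.Prime → ResolutionOfIsolatedInChar p) :=
  ⟨fun h => ⟨fun _ hp => isolatedModelsInChar_of_resSepExc h hp,
      fun _ hp => resolutionOfIsolatedInChar_of_resSepExc h hp⟩,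
    fun h => resSepExc_of h.1 h.2⟩

/-! ## Each named stub statement is closed by a crux of route `IsolatedCore` -/

/-- **`W` (stmt-18020) closes the first stub statement at every prime**, the hypothesis
`SepExc X` being idle: `IsolatedCore.FiniteSingularModels` hands every integral separated
finite-type `X` over a field of characteristic `p` a proper birational integral model all of
whose points are regular or closed (`exists_model_regular_or_isClosed_of_finiteSingularModels`).
[folklore] -/
theorem isolatedModelsInChar_of_finiteSingularModels (hW : IsolatedCore.FiniteSingularModels)
    {p : ℕ} (hp : p.Prime) : IsolatedModelsInChar p := by
  intro k _ _ _ X _ f hs hl hq _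
  haveI := hs; haveI := hl; haveI := hq
  exact exists_model_regular_or_isClosed_of_finiteSingularModels hW hp k X f

/-- **`K` (stmt-18021) closes the second stub statement at every prime**:
`IsolatedCore.IsolatedResolution` resolves every integral separated finite-type scheme over a
field of characteristic `p` all of whose points are regular or closed
(`hasResolution_of_isolatedResolution_of_regular_or_isClosed`; perfectness of the field is not
used). [folklore] -/
theorem resolutionOfIsolatedInChar_of_isolatedResolution (hK : IsolatedCore.IsolatedResolution)
    {p : ℕ} (hp : p.Prime) : ResolutionOfIsolatedInChar p := by
  intro k _ _ _ X _ f hs hl hq hX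
  haveI := hs; haveI := hl; haveI := hq
  exact hasResolution_of_isolatedResolution_of_regular_or_isClosed hK hp k X f hX

/-! ## Modulo the route's other crux `SepExcModels`, the first stub IS `W` on integral varieties
over perfect fields (lead c2) -/

/-- **`SepExcModels` and the first stub give isolated-singularity models of ALL integral
varieties over perfect fields** (the integral perfect-field case of `W` = stmt-18020, in the
line's `IsolatedSing` form): take the separably exceptional model `π₁ : X₁ → X` of the route's
crux `SepExcModels` (stmt-16828), then the isolated-singularity model `π₂ : X₂ → X₁` of the
separably exceptional `X₁` given by `IsolatedModelsInChar p`; `π₂ ≫ π₁` is proper and birational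
(`ComponentGluing.IsBirational.comp`). [folklore] -/
theorem exists_model_isolatedSing_of_sepExcModels_of_isolatedModelsInChar
    (hM : SharpStrata.SepExcModels) {p : ℕ} (hp : p.Prime) (h₁ : IsolatedModelsInChar p)
    (k : Type) [Field k] [CharP k p] [PerfectField k] (X : Scheme.{0}) [IsIntegral X]
    (f : X ⟶ Spec (.of k)) [IsSeparated f] [LocallyOfFiniteType f] [QuasiCompact f] :
    ∃ (X' : Scheme.{0}) (_ : IsIntegral X') (π : X' ⟶ X),
      IsProper π ∧ IsBirational π ∧ IsolatedSing X' := by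
  obtain ⟨X₁, hX₁, π₁, hπ₁, hb₁, hS₁⟩ := hM p hp k X f ‹_› ‹_› ‹_›
  haveI := hX₁; haveI := hπ₁
  obtain ⟨X₂, hX₂, π₂, hπ₂, hb₂, hiso⟩ :=
    h₁ k X₁ (π₁ ≫ f) inferInstance inferInstance inferInstance hS₁
  haveI := hX₂; haveI := hπ₂
  exact ⟨X₂, inferInstance, π₂ ≫ π₁, inferInstance, ComponentGluing.IsBirational.comp hb₂ hb₁, hiso⟩

/-- **Modulo `SepExcModels`, the first stub closes the integral perfect-field case of `W`**
(stmt-18020, verbatim conclusion shape: a proper birational REDUCED model with finitely many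
non-regular points): the isolated-singularity model of
`exists_model_isolatedSing_of_sepExcModels_of_isolatedModelsInChar` is integral, hence reduced,
and its non-regular points form a finite set (`finite_nonRegular_of_regular_or_isClosed` for
`π ≫ f`). With `isolatedModelsInChar_of_finiteSingularModels` (W ⇒ stub 1, no `SepExcModels`
needed) this pins stub 1 between `W` and `W|(integral, perfect)` on the route `SharpStrata`.
[folklore] -/
theorem finite_nonRegular_model_of_sepExcModels_of_isolatedModelsInChar
    (hM : SharpStrata.SepExcModels) {p : ℕ} (hp : p.Prime) (h₁ : IsolatedModelsInChar p)
    (k : Type) [Field k] [CharP k p] [PerfectField k] (X : Scheme.{0}) [IsIntegral X]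
    (f : X ⟶ Spec (.of k)) [IsSeparated f] [LocallyOfFiniteType f] [QuasiCompact f] :
    ∃ (X' : Scheme.{0}) (π : X' ⟶ X), IsProper π ∧ IsBirational π ∧ IsReduced X' ∧
      {x : X' | ¬ IsRegularLocalRing (X'.presheaf.stalk x)}.Finite := by
  obtain ⟨X', hX', π, hπ, hb, hiso⟩ :=
    exists_model_isolatedSing_of_sepExcModels_of_isolatedModelsInChar hM hp h₁ k X f
  haveI := hX'; haveI := hπ
  exact ⟨X', π, hπ, hb, inferInstance, finite_nonRegular_of_regular_or_isClosed X' (π ≫ f) hiso⟩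

/-- **Modulo `SepExcModels`, the two routes agree on integral varieties over perfect fields**:
`SepExcModels` and `ResSepExc` together give BOTH cruxes of route `IsolatedCore` restricted to
integral schemes over perfect fields of characteristic `p` — `W|(integral, perfect)`
(`finite_nonRegular_model_of_sepExcModels_of_isolatedModelsInChar` with
`isolatedModelsInChar_of_resSepExc`) and `K|(integral, perfect)`
(`hasResolution_of_resSepExc_of_finite_nonRegular`). So on this route the resolution content
beyond `SepExcModels` (Benito–Piltant–Reguera's Question 6.6) is exactly route `IsolatedCore`'s
content on integral varieties over perfect fields; `SepExc` buys nothing there. [folklore] -/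
theorem isolatedCore_integral_perfect_of_sepExcModels_of_resSepExc
    (hM : SharpStrata.SepExcModels) (hR : SharpStrata.ResSepExc) {p : ℕ} (hp : p.Prime)
    (k : Type) [Field k] [CharP k p] [PerfectField k] (X : Scheme.{0}) [IsIntegral X]
    (f : X ⟶ Spec (.of k)) [IsSeparated f] [LocallyOfFiniteType f] [QuasiCompact f] :
    (∃ (X' : Scheme.{0}) (π : X' ⟶ X), IsProper π ∧ IsBirational π ∧ IsReduced X' ∧
      {x : X' | ¬ IsRegularLocalRing (X'.presheaf.stalk x)}.Finite) ∧
    ({x : X | ¬ IsRegularLocalRing (X.presheaf.stalk x)}.Finite → Scheme.HasResolution X) :=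
  ⟨finite_nonRegular_model_of_sepExcModels_of_isolatedModelsInChar hM hp
      (isolatedModelsInChar_of_resSepExc hR hp) k X f,
    fun hfin => hasResolution_of_resSepExc_of_finite_nonRegular hR hp k X f hfin⟩

end Summit.ResolutionOfSingularities.ResolutionOfSingularities.Theorems.SharpStrata

end
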